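import Literature.AlgebraicGeometry.Resolution.HasseSchmidtDerivatives
import HarnessLib

/-!
# Differential operators on a polynomial ring in ONE variable are combinations of Hasse–Schmidt derivatives

Topic: `Literature/AlgebraicGeometry/Resolution`; companion of `HasseSchmidtDerivatives.lean` (Taylor morphism,
Hasse–Schmidt derivatives `D^{(α)}`, `HasseSchmidtDiff σ R n = span{D^{(α)} : |α| ≤ n} ≤ diffOp`, and the NAMED
FACT `hasseSchmidtDiff_eq_diffOp` = EGA IV₄ Thm. 16.11.2 «les `D_p` tels que `|p| ≤ m` forment une base du
`𝒪_U`-Module `Diff^m`» for finitely many variables). This file PROVES the one-variable case of that named fact,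
for ANY commutative base ring `R` (any characteristic):

* `IsDiffOpLE.eq_zero_of_apply_monomial` — **uniqueness** (any number of variables): a differential operator
  of order `≤ n` on `R[x_i : i ∈ σ]` which kills every monomial of degree `≤ n` is zero (induction on `n`:
  `[E, x_i]` has order `≤ n − 1` and kills the monomials of degree `≤ n − 1`; an `E` with all `[E, x_i] = 0`
  is `R[x]`-linear, hence `E = E(1)·id = 0`);
* `exists_hasseSchmidtDiff_interpolate` — **interpolation** (one variable `y`): for every `R`-linear `D` there
  is `H ∈ HasseSchmidtDiff` of order `≤ n` with `H(y^j) = D(y^j)` for all `j ≤ n` (the matrix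
  `D^{(k)}(y^j) = (j choose k) y^{j−k}` is unitriangular);
* `diffOp_eq_hasseSchmidtDiff` — **`Diff^{≤ n}_{R[y]/R} = ⊕_{k ≤ n} R[y]·D^{(k)}`** (as `R[y]`-submodules of
  `End_R(R[y])`; one variable = `[Unique σ]`), i.e. `hasseSchmidtDiff_eq_diffOp_of_unique`, the case
  `Fintype.card σ = 1` of the named fact; `IsDiffOpLE.mem_hasseSchmidtDiff` (membership form) and
  `IsDiffOpLE.induction_hasse` (to prove a property of all operators of order `≤ n` it suffices to check it on
  the `D^{(k)}`, `k ≤ n`, and that it is stable under `0`, `+`, `f •`).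

The general finite-`σ` statement (multi-index interpolation) is NOT proved here; the uniqueness half is.

## References

* [EGAIV4] A. Grothendieck, J. Dieudonné, ÉGA IV₄ (Publ. Math. IHÉS 32, 1967), Thm. 16.11.2 and (16.11.2.1)
  `D_p(z^q) = (q choose p) z^{q−p}`; Prop. 16.8.8 (the order via commutators).
* [VillamayorU2008ReesDiff] O. Villamayor U., Rev. Mat. Iberoam. 24 (2008), §2.6 («`{Δ^α, 0 ≤ |α| ≤ N}` is a basis
  of the `B`-module of `S`-differential operators on `B` of order `≤ N`», `B = S[X_1,…,X_n]`).
-/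

noncomputable section

open MvPolynomial

namespace Literature.AlgebraicGeometry.Resolution

universe u v

/-! ### Commutator calculus: `a ↦ [E, a]` is a derivation -/

section Commutator

variable (R : Type u) {A : Type v} [CommSemiring R] [CommRing A] [Algebra R A]

/-- `[E, a + b] = [E, a] + [E, b]`. [cite: EGAIV4, Prop. 16.8.8 (16.8.8.1)] -/
theorem commMul_add_right (E : A →ₗ[R] A) (a b : A) :
    commMul R E (a + b) = commMul R E a + commMul R E b := by
  ext t; simp only [commMul_apply, LinearMap.add_apply, add_mul, map_add]; ring

/-- **Leibniz rule for the commutator**: `[E, a·b] = [E, a] ∘ (b·) + (a·) ∘ [E, b]`.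
[cite: EGAIV4, Prop. 16.8.8 (proof, (16.8.8.2))] -/
theorem commMul_mul_right (E : A →ₗ[R] A) (a b : A) :
    commMul R E (a * b) = commMul R E a ∘ₗ LinearMap.mulLeft R b + LinearMap.mulLeft R a ∘ₗ commMul R E b := by
  ext t
  simp only [commMul_apply, LinearMap.add_apply, LinearMap.comp_apply, LinearMap.mulLeft_apply, mul_sub]
  ring_nf

/-- `[E, r·1] = 0` for scalars `r ∈ R` (`E` is `R`-linear). [cite: EGAIV4, Prop. 16.8.8] -/
theorem commMul_algebraMap (E : A →ₗ[R] A) (r : R) : commMul R E (algebraMap R A r) = 0 := by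
  ext t
  simp only [commMul_apply, LinearMap.zero_apply, ← Algebra.smul_def, map_smul, sub_self]

/-- An `R`-linear `E` commuting with every multiplication and killing `1` is zero (an operator of order `≤ 0`
is the multiplication by `E 1`). [cite: EGAIV4, Prop. 16.8.8 (order ≤ 0 = A-linear)] -/
theorem eq_zero_of_commMul_eq_zero (E : A →ₗ[R] A) (h : ∀ a, commMul R E a = 0) (h1 : E 1 = 0) :
    E = 0 := by
  ext t
  have := LinearMap.congr_fun (h t) 1
  rw [commMul_apply, mul_one, h1, mul_zero, sub_zero, LinearMap.zero_apply] at this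
  rw [this, LinearMap.zero_apply]

end Commutator

/-! ### Uniqueness: an operator of order `≤ n` killing the monomials of degree `≤ n` is zero (any `σ`) -/

section Uniqueness

variable {σ : Type u} (R : Type v) [CommRing R]

/-- On `R[x_i : i ∈ σ]`: if `[E, x_i] = 0` for every variable then `[E, a] = 0` for every `a`
(`a ↦ [E,a]` is a derivation-like map vanishing on the generators). [cite: EGAIV4, Prop. 16.8.8] -/
theorem commMul_eq_zero_of_commMul_X (E : MvPolynomial σ R →ₗ[R] MvPolynomial σ R)
    (h : ∀ i : σ, commMul R E (X i) = 0) (a : MvPolynomial σ R) : commMul R E a = 0 := by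
  induction a using MvPolynomial.induction_on with
  | C r => exact commMul_algebraMap R E r
  | add p q hp hq => rw [commMul_add_right, hp, hq, add_zero]
  | mul_X p i hp => rw [commMul_mul_right, hp, h i, LinearMap.zero_comp, LinearMap.comp_zero, add_zero]

/-- **Uniqueness half of EGA IV₄ 16.11.2** (every `σ`, every `R`): a differential operator of order `≤ n` on
the polynomial ring `R[x_i : i ∈ σ]` which vanishes on all monomials `x^β` with `|β| ≤ n` is zero.
[cite: EGAIV4, Thm. 16.11.2] -/
theorem IsDiffOpLE.eq_zero_of_apply_monomial :
    ∀ (n : ℕ) {E : MvPolynomial σ R →ₗ[R] MvPolynomial σ R}, IsDiffOpLE R n E →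
      (∀ β : σ →₀ ℕ, β.degree ≤ n → E (monomial β 1) = 0) → E = 0 := by
  intro n
  induction n with
  | zero =>
    intro E hE hmon
    refine eq_zero_of_commMul_eq_zero R E hE ?_
    simpa using hmon 0 (by simp)
  | succ n ih =>
    intro E hE hmon
    have hX : ∀ i : σ, commMul R E (X i) = 0 := fun i => by
      refine ih (hE (X i)) fun β hβ => ?_
      rw [commMul_apply, hmon β (by omega), mul_zero, sub_zero]
      have hm : (X i : MvPolynomial σ R) * monomial β 1 = monomial (β + Finsupp.single i 1) 1 := by
        rw [X, monomial_mul, one_mul, add_comm]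
      rw [hm]
      exact hmon _ (by rw [map_add, Finsupp.degree_single]; omega)
    refine eq_zero_of_commMul_eq_zero R E (commMul_eq_zero_of_commMul_X R E hX) ?_
    simpa using hmon 0 (by simp)

/-- Consequently two operators of order `≤ n` agreeing on the monomials of degree `≤ n` are equal.
[cite: EGAIV4, Thm. 16.11.2] -/
theorem IsDiffOpLE.eq_of_apply_monomial {n : ℕ} {D E : MvPolynomial σ R →ₗ[R] MvPolynomial σ R}
    (hD : IsDiffOpLE R n D) (hE : IsDiffOpLE R n E)
    (h : ∀ β : σ →₀ ℕ, β.degree ≤ n → D (monomial β 1) = E (monomial β 1)) : D = E := by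
  have := IsDiffOpLE.eq_zero_of_apply_monomial R n (hD.sub hE) fun β hβ => by
    rw [LinearMap.sub_apply, h β hβ, sub_self]
  exact sub_eq_zero.mp this

end Uniqueness

/-! ### One variable: interpolation by Hasse–Schmidt derivatives and the basis theorem -/

section OneVariable

variable {σ : Type u} [Unique σ] (R : Type v) [CommRing R]

/-- In one variable `y = x_default`, the monomial `x^β` is `y^{β(default)}`. [folklore] -/
private theorem monomial_eq_X_pow (β : σ →₀ ℕ) :
    (monomial β (1 : R) : MvPolynomial σ R) = X default ^ (β default) := by
  conv_lhs => rw [Finsupp.unique_single β]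
  rw [X_pow_eq_monomial]

/-- In one variable, `|β| = β(default)`. [folklore] -/
private theorem degree_eq_apply (β : σ →₀ ℕ) : β.degree = β default := by
  conv_lhs => rw [Finsupp.unique_single β]
  rw [Finsupp.degree_single]

/-- **Interpolation of the delta functions**: for `j ≤ n` there is `H ∈ HasseSchmidtDiff` (order `≤ n`) with
`H(y^l) = δ_{lj}` for all `l ≤ n` (downward induction on `j`: start from `D^{(j)}`, whose values
`D^{(j)}(y^l) = (l choose j) y^{l−j}` vanish for `l < j` and equal `1` at `l = j`, and correct the values at
`l > j`). [cite: EGAIV4, Thm. 16.11.2 with (16.11.2.1)] -/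
theorem exists_hasseSchmidtDiff_delta [DecidableEq σ] (n : ℕ) :
    ∀ k j : ℕ, j + k = n → ∃ H ∈ HasseSchmidtDiff σ R n,
      ∀ l : ℕ, l ≤ n → H (X default ^ l) = if l = j then 1 else 0 := by
  intro k
  induction k using Nat.strong_induction_on with
  | _ k ih =>
    intro j hjk
    -- the correcting operators `H_i`, `j < i ≤ n`
    have hcorr : ∀ i : ℕ, j < i → i ≤ n → ∃ H ∈ HasseSchmidtDiff σ R n,
        ∀ l : ℕ, l ≤ n → H (X default ^ l) = if l = i then 1 else 0 := fun i hji hin =>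
      ih (n - i) (by omega) i (by omega)
    choose! Hc hHc_mem hHc_val using hcorr
    refine ⟨hasseDeriv R (Finsupp.single default j) -
        ∑ i ∈ Finset.Ioc j n, ((i.choose j : MvPolynomial σ R) * X default ^ (i - j)) • Hc i, ?_, ?_⟩
    · refine Submodule.sub_mem _ (hasseDeriv_mem_hasseSchmidtDiff σ R (by rw [Finsupp.degree_single]; omega))
        (Submodule.sum_mem _ fun i hi => Submodule.smul_mem _ _ (hHc_mem i ?_ ?_))
      · exact (Finset.mem_Ioc.mp hi).1
      · exact (Finset.mem_Ioc.mp hi).2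
    · intro l hl
      rw [LinearMap.sub_apply, LinearMap.sum_apply, hasseDeriv_X_pow]
      have hsum : (∑ i ∈ Finset.Ioc j n, (((i.choose j : MvPolynomial σ R) * X default ^ (i - j)) • Hc i)
            (X default ^ l)) = if j < l then (l.choose j : MvPolynomial σ R) * X default ^ (l - j) else 0 := by
        have hterm : ∀ i ∈ Finset.Ioc j n, (((i.choose j : MvPolynomial σ R) * X default ^ (i - j)) • Hc i)
              (X default ^ l) = if i = l then (l.choose j : MvPolynomial σ R) * X default ^ (l - j) else 0 := by
          intro i hi
          obtain ⟨hji, hin⟩ := Finset.mem_Ioc.mp hi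
          rw [LinearMap.smul_apply, hHc_val i hji hin l hl, smul_eq_mul]
          by_cases hil : i = l
          · subst hil; simp
          · rw [if_neg (Ne.symm hil), if_neg hil, mul_zero]
        rw [Finset.sum_congr rfl hterm, Finset.sum_ite_eq' (Finset.Ioc j n) l]
        simp only [Finset.mem_Ioc]
        by_cases hjl : j < l
        · rw [if_pos ⟨hjl, hl⟩, if_pos hjl]
        · rw [if_neg (fun h => hjl h.1), if_neg hjl]
      rw [hsum]
      by_cases hlj : l = j
      · subst hlj; simp
      · rcases lt_or_gt_of_ne hlj with hlt | hgt
        · rw [if_neg (not_lt.mpr hlt.le), if_neg hlj, Nat.choose_eq_zero_of_lt hlt, Nat.cast_zero, zero_mul,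
            sub_zero]
        · rw [if_pos hgt, if_neg hlj, sub_self]

/-- **Interpolation**: for every `R`-linear endomorphism `D` of `R[y]` and every `n` there is an `H` in the span of
the Hasse–Schmidt derivatives of order `≤ n` with `H(y^l) = D(y^l)` for all `l ≤ n`.
[cite: EGAIV4, Thm. 16.11.2] -/
theorem exists_hasseSchmidtDiff_interpolate [DecidableEq σ] (n : ℕ)
    (D : MvPolynomial σ R →ₗ[R] MvPolynomial σ R) :
    ∃ H ∈ HasseSchmidtDiff σ R n, ∀ l : ℕ, l ≤ n → H (X default ^ l) = D (X default ^ l) := by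
  have hdelta : ∀ j : ℕ, j ≤ n → ∃ H ∈ HasseSchmidtDiff σ R n,
      ∀ l : ℕ, l ≤ n → H (X default ^ l) = if l = j then 1 else 0 := fun j hj =>
    exists_hasseSchmidtDiff_delta R n (n - j) j (by omega)
  choose! Hd hHd_mem hHd_val using hdelta
  refine ⟨∑ j ∈ Finset.range (n + 1), D (X default ^ j) • Hd j,
    Submodule.sum_mem _ fun j hj => Submodule.smul_mem _ _ (hHd_mem j ?_), fun l hl => ?_⟩
  · exact Nat.lt_succ_iff.mp (Finset.mem_range.mp hj)
  · rw [LinearMap.sum_apply]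
    have hterm : ∀ j ∈ Finset.range (n + 1), (D (X default ^ j) • Hd j) (X default ^ l) =
        if l = j then D (X default ^ l) else 0 := by
      intro j hj
      rw [LinearMap.smul_apply, hHd_val j (Nat.lt_succ_iff.mp (Finset.mem_range.mp hj)) l hl, smul_eq_mul]
      split_ifs with h
      · subst h; rw [mul_one]
      · rw [mul_zero]
    rw [Finset.sum_congr rfl hterm, Finset.sum_ite_eq (Finset.range (n + 1)) l, if_pos]
    exact Finset.mem_range.mpr (Nat.lt_succ_of_le hl)

/-- **EGA IV₄ 16.11.2 in one variable**: every differential operator of order `≤ n` of `R[y]` over `R` lies in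
the `R[y]`-span of the Hasse–Schmidt derivatives `D^{(k)}`, `k ≤ n`. [cite: EGAIV4, Thm. 16.11.2] -/
theorem IsDiffOpLE.mem_hasseSchmidtDiff [DecidableEq σ] {n : ℕ} {D : MvPolynomial σ R →ₗ[R] MvPolynomial σ R}
    (hD : IsDiffOpLE R n D) : D ∈ HasseSchmidtDiff σ R n := by
  obtain ⟨H, hH, hval⟩ := exists_hasseSchmidtDiff_interpolate R n D
  have hHop : IsDiffOpLE R n H := hasseSchmidtDiff_le_diffOp σ R n hH
  have hDH : D = H := IsDiffOpLE.eq_of_apply_monomial R hD hHop fun β hβ => by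
    rw [monomial_eq_X_pow]
    rw [degree_eq_apply] at hβ
    exact (hval _ hβ).symm
  rw [hDH]; exact hH

/-- **`Diff^{≤ n}_{R[y]/R} = span{D^{(k)} : k ≤ n}`** — the one-variable case of the named fact
`hasseSchmidtDiff_eq_diffOp` (EGA IV₄ 16.11.2), proved. [cite: EGAIV4, Thm. 16.11.2] -/
theorem diffOp_eq_hasseSchmidtDiff [DecidableEq σ] (n : ℕ) :
    diffOp R (MvPolynomial σ R) n = HasseSchmidtDiff σ R n :=
  le_antisymm (fun _ hD => IsDiffOpLE.mem_hasseSchmidtDiff R hD) (hasseSchmidtDiff_le_diffOp σ R n)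

/-- The same equality in the orientation of the named fact: `HasseSchmidtDiff σ R n = diffOp R R[y] n` for
`σ` a one-element index type. [cite: EGAIV4, Thm. 16.11.2] -/
theorem hasseSchmidtDiff_eq_diffOp_of_unique [DecidableEq σ] (n : ℕ) :
    HasseSchmidtDiff σ R n = diffOp R (MvPolynomial σ R) n :=
  (diffOp_eq_hasseSchmidtDiff R n).symm

/-- **Induction principle for `Diff^{≤ n}_{R[y]/R}`**: a property of `R`-linear endomorphisms of `R[y]` which holds
for the Hasse–Schmidt derivatives `D^{(α)}` with `|α| ≤ n` and is stable under `0`, `+` and `f • ·` holds for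
every differential operator of order `≤ n`. [cite: EGAIV4, Thm. 16.11.2] -/
theorem IsDiffOpLE.induction_hasse [DecidableEq σ] {n : ℕ}
    {P : (MvPolynomial σ R →ₗ[R] MvPolynomial σ R) → Prop}
    (hgen : ∀ α : σ →₀ ℕ, α.degree ≤ n → P (hasseDeriv R α)) (h0 : P 0)
    (hadd : ∀ D E, P D → P E → P (D + E)) (hsmul : ∀ (f : MvPolynomial σ R) (D), P D → P (f • D))
    {D : MvPolynomial σ R →ₗ[R] MvPolynomial σ R} (hD : IsDiffOpLE R n D) : P D := by
  have hmem := IsDiffOpLE.mem_hasseSchmidtDiff R hD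
  clear hD
  unfold HasseSchmidtDiff at hmem
  induction hmem using Submodule.span_induction with
  | mem D hD' => obtain ⟨α, hα, rfl⟩ := hD'; exact hgen α hα
  | zero => exact h0
  | add D E _ _ hD' hE' => exact hadd D E hD' hE'
  | smul f D _ hD' => exact hsmul f D hD'

end OneVariable

end Literature.AlgebraicGeometry.Resolution

end
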